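import Literature.AlgebraicGeometry.Resolution.PointBlowupOrder
import Literature.AlgebraicGeometry.Resolution.DivisorialPart
import Literature.AlgebraicGeometry.Resolution.MarkedIdealsLemmas
import Literature.AlgebraicGeometry.Resolution.MonomialOrderReductionUnit
import Literature.AlgebraicGeometry.Resolution.SymbolicPowersRegularQuotient
import Literature.AlgebraicGeometry.Resolution.SubschemeRegularStalks
import Literature.AlgebraicGeometry.Resolution.RegularQuotientIdeal
import Literature.AlgebraicGeometry.Resolution.RegularLocalRingsProofs
import Literature.AlgebraicGeometry.Resolution.RegularBlowup
import Literature.AlgebraicGeometry.Resolution.BlowupsIntegral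
import HarnessLib

/-!
# One permissible blowing up in Cossart–Piltant's principalization (CoP1, proof of Prop. 4.2)

Topic: `Literature/AlgebraicGeometry/Resolution`. The bookkeeping of a single blowing up in the
reduction "Prop. 4.2 ⇐ Prop. 4.4" of [CoP1] = Cossart–Piltant, J. Algebra 320 (2008), proof of
Prop. 4.2 (pp. 7–8): `I = H · J` with `H` invertible and "`V(J)` has codimension at least two in
`X`", `μ = max ord J`, `Σ = {x | ord_x J = μ}`, and a blowing up `τ : X' → X` along a centre `Y`
"permissible … if `Y` is regular … and `Y ⊆ Σ`", with weak (controlled) transform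
`J' = I(Y)^{-μ} J` — PROVED over the tree (`MarkedIdeals.lean`, `MarkedIdealsLemmas.lean`,
`PointBlowupOrder.lean`, `DivisorialPart.lean`, `BlowupStalkCharts.lean`,
`BlowupChartQuasiRegular.lean`):

* chart algebra (`comap_span_chartBase_self`, `isPrime_span_chartBase_self`,
  `eval₂Hom_chartGen_not_mem_span`, `exists_weakTransform_chart_not_mem_span`): the exceptional
  ideal `(φ c_j)` of the chart `B_j = R[(c)/c_j]` (`c` quasi-regular) contracts to `(c)`, is
  prime when `R/(c)` is a domain, and does not contain the weak transform `F(e)` of an element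
  with initial form `F ≠ 0`; `Ideal.eq_of_le_of_height_le_one_of_mem_nonZeroDivisors`;
* `le_vanishingIdeal_pow_of_forall_idealOrder_eq` — `J ⊆ 𝓘_Y^μ` when `ord_y J = μ` along the
  regular centre `Y` (symbolic powers of primes with regular quotient are ordinary powers);
  hence `𝓘_E^μ · J' = J𝒪_{X'}` (`IsBlowup.pow_mul_controlledTransform_eq_of_forall_idealOrder_eq`);
* `IsBlowup.stalkIdeal_controlledTransform_eq_top_of_coheight_le_one` — **the weak transform
  is the unit ideal at every point of the exceptional divisor of codimension `≤ 1`**: such a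
  point `x'` lies over the generic point of `Y` (its local ring is the localization of a chart
  `B_j = 𝒪_{X,s}[P/c_j]` at a height-one prime containing the prime `(c_j)`,
  `B_j/(c_j) ≅ (𝒪_{X,s}/P)[T]`), where the weak transform `f' = F(e)` of an element `f ∈ J_s`
  of order `μ` with initial form `F` is a unit (`F(T_j := 1) ≠ 0`);
* `IsBlowup.mem_support_and_coheight_eq_of_not_mem` (off `E` nothing changes) and
  `IsBlowup.one_lt_coheight_of_mem_support_controlledTransform` — consequently **"`V(J')` has
  codimension at least two" again**;
* `not_isLocallyPrincipalAt_mul_of_forall_one_lt_coheight` — a point of `V(J)`, `V(J)` of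
  codimension `≥ 2`, is a point where `H · J` is not locally principal (`H` invertible), i.e.
  permissible centres lie in the non-locally-principal locus of `I𝒪`;
* `vanishingIdeal_ne_bot_of_forall_idealOrder_eq` — such a centre misses the generic point.

## Sources

* V. Cossart, O. Piltant, J. Algebra 320 (2008) 1051–1082, proof of Prop. 4.2, pp. 7–8.
  [CossartPiltant2008]
* V. Cossart, O. Piltant, J. Algebra 529 (2019), Prop. 4.4 (arXiv v1: Prop. 4.3).
  [CossartPiltant2019]
-/

noncomputable section

open CategoryTheory CategoryTheory.Limits AlgebraicGeometry TopologicalSpace IsLocalRing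

namespace Literature.AlgebraicGeometry.Resolution

universe u

open Scheme.IdealSheafData

/-! ## Chart algebra: the exceptional ideal `(φ c_j)` of the chart `B_j = R[(c)/c_j]` -/

section ChartAlgebra

variable {R : Type u} [CommRing R] {k : ℕ} (c : Fin k → R) (j : Fin k)

/-- **`(φ c_j) ∩ R = (c)`**: the exceptional ideal of the chart `B_j = (R[It])_{(c_j t)}`,
`I = (c)` quasi-regular, contracts to the centre (the composite `R → B_j/(c_j) ≅ (R/I)[T]` has
kernel `I`). [cite: StacksProject, Tag 0BIQ] -/
theorem comap_span_chartBase_self (hcq : IsQuasiRegular c) :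
    (Ideal.span {chartBase c j (c j)}).comap (chartBase c j) = Ideal.span (Set.range c) := by
  refine le_antisymm (fun r hr => ?_) fun r hr => ?_
  · rw [Ideal.mem_comap] at hr
    have h1 : chartQuotMap c j (MvPolynomial.C (Ideal.Quotient.mk _ r)) = chartQuotMap c j 0 := by
      rw [chartQuotMap_C, map_zero, Ideal.Quotient.eq_zero_iff_mem]
      exact hr
    have h2 := (chartQuotMap_bijective c j hcq).1 h1
    rw [MvPolynomial.C_eq_zero, Ideal.Quotient.eq_zero_iff_mem] at h2
    exact h2
  · exact reesChartBase_mem_span_of_mem c j hr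

/-- **`(φ c_j)` is a prime ideal of the chart** when `R/(c)` is a domain (`c` quasi-regular):
`B_j/(φ c_j) ≅ (R/(c))[T_l : l ≠ j]`. [cite: StacksProject, Tag 0BIQ] -/
theorem isPrime_span_chartBase_self (hcq : IsQuasiRegular c)
    [IsDomain (R ⧸ Ideal.span (Set.range c))] :
    (Ideal.span {chartBase c j (c j)}).IsPrime := by
  rw [← Ideal.Quotient.isDomain_iff_prime]
  exact MulEquiv.isDomain (MvPolynomial {l : Fin k // l ≠ j} (R ⧸ Ideal.span (Set.range c)))
    (chartQuotEquiv c j hcq).symm.toMulEquiv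

/-- **The weak transform of an element of order `ν` does not vanish along the exceptional
divisor** ([CoP1] (11) at the generic point of `E`): for a form `F` of degree `ν` in the
quasi-regular generators `c` of `𝔪 = (c)` with non-zero reduction `F̄` modulo `(c)`, the weak
transform `f' = F(e)` is not in `(φ c_j)` — its image in `B_j/(φ c_j) ≅ (R/(c))[T_l : l ≠ j]` is
`F̄(T_j := 1) ≠ 0`. [cite: CossartPiltant2008, proof of Prop. 4.2, (11)] -/
theorem eval₂Hom_chartGen_not_mem_span (hcq : IsQuasiRegular c) {F : MvPolynomial (Fin k) R}
    {ν : ℕ} (hF : F.IsHomogeneous ν)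
    (hF0 : MvPolynomial.map (Ideal.Quotient.mk (Ideal.span (Set.range c))) F ≠ 0) :
    (MvPolynomial.eval₂Hom (chartBase c j) (fun l => chartGen c j l) F) ∉
      Ideal.span {chartBase c j (c j)} := by
  classical
  intro hmem
  set g : MvPolynomial {l : Fin k // l ≠ j} (R ⧸ Ideal.span (Set.range c)) :=
    MvPolynomial.map (Ideal.Quotient.mk _) (dehomogenize j F) with hg
  have hg0 : g ≠ 0 := by
    rw [hg, map_dehomogenize]
    exact dehomogenize_ne_zero_of_isHomogeneous j (hF.map _) hF0
  have hquot : chartQuotMap c j g = Ideal.Quotient.mk (Ideal.span {chartBase c j (c j)})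
      (MvPolynomial.eval₂Hom (chartBase c j) (fun l => chartGen c j l) F) := by
    rw [hg, ← RingHom.comp_apply, chartQuotMap_comp_map, RingHom.comp_apply]
    congr 1
    exact RingHom.congr_fun (eval₂Hom_comp_aeval_kill c j) F
  rw [Ideal.Quotient.eq_zero_iff_mem.mpr hmem, ← map_zero (chartQuotMap c j)] at hquot
  exact hg0 ((chartQuotMap_bijective c j hcq).1 hquot)

/-- **The weak transform of an element of order `ν`, chart form**: for `f ∈ 𝔪^ν ∖ 𝔪^{ν+1}` in a
regular local ring with `𝔪 = (c)`, `c` quasi-regular, there is `f' ∈ B_j` with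
`φ(f) = φ(c_j)^ν f'` and `f' ∉ (φ c_j)` ([CoP1] (11): `y₁^{-μ} f ≡ F(1, y₂', y₃') mod (y₁')`
with `F = in(f) ≠ 0`). [cite: CossartPiltant2008, proof of Prop. 4.2, (11)] -/
theorem exists_weakTransform_chart_not_mem_span [IsRegularLocalRing R]
    (hc : Ideal.span (Set.range c) = maximalIdeal R) (hcq : IsQuasiRegular c) {f : R} {ν : ℕ}
    (hf : f ∈ maximalIdeal R ^ ν) (hf' : f ∉ maximalIdeal R ^ (ν + 1)) :
    ∃ f' : chartRing c j, chartBase c j f = chartBase c j (c j) ^ ν * f' ∧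
      f' ∉ Ideal.span {chartBase c j (c j)} := by
  obtain ⟨F, hF, hFf, hF0⟩ := exists_isHomogeneous_eval_eq_map_residue_ne_zero c hc hf hf'
  refine ⟨MvPolynomial.eval₂Hom (chartBase c j) (fun l => chartGen c j l) F, ?_,
    eval₂Hom_chartGen_not_mem_span c j hcq hF hF0⟩
  rw [← hFf]
  exact reesChartBase_eval_eq_pow_mul_eval₂ c j hF

end ChartAlgebra

/-- A prime `𝔴` of height `≤ 1` containing a prime `K` which contains a nonzerodivisor equals `K`
(`0 < ht K ≤ ht 𝔴 ≤ 1`). [folklore] -/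
theorem Ideal.eq_of_le_of_height_le_one_of_mem_nonZeroDivisors {B : Type*} [CommRing B]
    {K 𝔴 : Ideal B} [K.IsPrime] [𝔴.IsPrime] (hK𝔴 : K ≤ 𝔴) (h𝔴 : 𝔴.height ≤ 1) {b : B}
    (hbK : b ∈ K) (hb : b ∈ nonZeroDivisors B) : K = 𝔴 := by
  have hKht : K.height ≠ 0 := by
    intro h0
    rw [Ideal.height_eq_zero_iff] at h0
    exact Set.disjoint_left.mp (Ideal.disjoint_nonZeroDivisors_of_mem_minimalPrimes h0) hbK hb
  by_contra hne
  have hKfin : K.height ≠ ⊤ :=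
    ne_top_of_le_ne_top (by decide) ((Ideal.height_mono hK𝔴).trans h𝔴)
  haveI : K.FiniteHeight := ⟨Or.inr hKfin⟩
  have hlt := Ideal.height_strict_mono_of_isPrime (lt_of_le_of_ne hK𝔴 hne)
  have h1 : (1 : ℕ∞) ≤ K.height := Order.one_le_iff_ne_zero.mpr hKht
  exact lt_irrefl _ (h1.trans_lt (hlt.trans_le h𝔴))

/-! ## `J ⊆ 𝓘_Y^μ` along a regular centre inside `{ord = μ}` -/

section Centre

variable {X : Scheme.{u}}

/-- **`J ⊆ 𝓘_Y^μ` for a regular centre `Y ⊆ {x | ord_x J = μ}`** on a regular locally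
Noetherian scheme: at `y ∈ Y` the stalk `P = 𝓘_{Y,y}` is a prime with regular quotient, the
point `ζ` of `P` lies on `Y` (`𝓘_{Y,ζ} = 𝔪_ζ`), so `J_y 𝒪_{X,ζ} ⊆ 𝔪_ζ^μ`, i.e.
`J_y ⊆ P^{(μ)} = P^μ` (`comap_map_pow_eq_pow_of_isRegularLocalRing_quotient`). This is the
inclusion `J ⊆ I(Y)^μ` implicit in [CoP1]'s weak transform `J' = I(Y)^{-μ} J`.
[cite: CossartPiltant2008, proof of Prop. 4.2] -/
theorem le_vanishingIdeal_pow_of_forall_idealOrder_eq [IsLocallyNoetherian X]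
    (hX : Scheme.IsRegular X) {Y : Closeds X}
    (hreg : Scheme.IsRegular (vanishingIdeal Y).subscheme) {J : X.IdealSheafData} {μ : ℕ}
    (hY : ∀ y ∈ (Y : Set X), idealOrder J y = μ) : J ≤ vanishingIdeal Y ^ μ := by
  refine le_of_forall_stalkIdeal_le fun x => ?_
  rw [stalkIdeal_pow]
  by_cases hx : x ∈ (vanishingIdeal Y).support
  swap
  · rw [stalkIdeal_eq_top_of_not_mem_support hx, Ideal.top_pow]
    exact le_top
  haveI := hX x
  set P : Ideal (X.presheaf.stalk x) := stalkIdeal (vanishingIdeal Y) x with hPdef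
  haveI hPq : IsRegularLocalRing (X.presheaf.stalk x ⧸ P) :=
    isRegularLocalRing_stalk_quotient_stalkIdeal hreg hx
  haveI : IsDomain (X.presheaf.stalk x ⧸ P) := isDomain_of_isRegularLocalRing _
  haveI hP : P.IsPrime := (Ideal.Quotient.isDomain_iff_prime P).mp inferInstance
  -- the point `y` of the prime `P`
  obtain ⟨y, φ, hloc, hst⟩ := exists_isLocalizationAtPrime_stalk x P
  letI := φ.toAlgebra
  haveI : IsLocalization.AtPrime (X.presheaf.stalk y) P := hloc
  have hCy : stalkIdeal (vanishingIdeal Y) y = maximalIdeal (X.presheaf.stalk y) := by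
    rw [hst, ← hPdef]
    exact IsLocalization.AtPrime.map_eq_maximalIdeal P (X.presheaf.stalk y)
  have hy : y ∈ (Y : Set X) := by
    rw [← coe_support_vanishingIdeal Y]
    exact (mem_support_iff_stalkIdeal_le _ y).mpr hCy.le
  have hJy : stalkIdeal J y ≤ maximalIdeal (X.presheaf.stalk y) ^ μ :=
    (le_idealOrder_iff J y μ).mp (hY y hy).ge
  -- `J_x 𝒪_{X,y} ⊆ (P 𝒪_{X,y})^μ`, hence `J_x ⊆ P^{(μ)} = P^μ`
  have key : (stalkIdeal J x).map (algebraMap _ (X.presheaf.stalk y)) ≤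
      (P ^ μ).map (algebraMap _ (X.presheaf.stalk y)) := by
    rw [Ideal.map_pow, IsLocalization.AtPrime.map_eq_maximalIdeal P (X.presheaf.stalk y),
      RingHom.algebraMap_toAlgebra, ← hst J]
    exact hJy
  have := Ideal.le_comap_of_map_le key
  rwa [comap_map_pow_eq_pow_of_isRegularLocalRing_quotient P (X.presheaf.stalk y) μ] at this

/-- Points of a centre inside `{ord ≥ 1}` lie in `V(J)`; in particular the generic point of an
integral scheme is not on such a centre and `𝓘_Y ≠ 0`. [folklore] -/
theorem vanishingIdeal_ne_bot_of_forall_idealOrder_eq [IsIntegral X] {Y : Closeds X}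
    {J : X.IdealSheafData} (hJ : J ≠ ⊥) {μ : ℕ} (hμ : 1 ≤ μ)
    (hY : ∀ y ∈ (Y : Set X), idealOrder J y = μ) : vanishingIdeal Y ≠ ⊥ := by
  intro h
  have hgen : genericPoint X ∈ (Y : Set X) := by
    rw [← coe_support_vanishingIdeal Y, h, Scheme.IdealSheafData.support_bot]
    trivial
  refine not_mem_support_genericPoint hJ ((one_le_idealOrder_iff J _).mp ?_)
  rw [hY _ hgen]
  exact_mod_cast hμ

end Centre

/-! ## The weak transform along one permissible blowing up -/

section Transform

variable {X X' : Scheme.{u}} {π : X' ⟶ X}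

/-- **`𝓘_E^μ · J' = J𝒪_{X'}`** for the weak transform `J' = (J𝒪_{X'} : 𝓘_E^μ)` under a blowing
up along a regular centre `Y ⊆ {ord_x J = μ}` of a regular locally Noetherian scheme
(`J ⊆ 𝓘_Y^μ`, `le_vanishingIdeal_pow_of_forall_idealOrder_eq`, and `𝓘_E` is invertible).
[cite: CossartPiltant2008, proof of Prop. 4.2] -/
theorem IsBlowup.pow_mul_controlledTransform_eq_of_forall_idealOrder_eq [IsLocallyNoetherian X]
    [IsLocallyNoetherian X'] (hX : Scheme.IsRegular X) {Y : Closeds X}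
    (hreg : Scheme.IsRegular (vanishingIdeal Y).subscheme) (hπ : IsBlowup π (vanishingIdeal Y))
    {J : X.IdealSheafData} {μ : ℕ} (hY : ∀ y ∈ (Y : Set X), idealOrder J y = μ) :
    (vanishingIdeal Y).comap π ^ μ * controlledTransform π (vanishingIdeal Y) J μ = J.comap π :=
  pow_mul_controlledTransform_eq π _ hπ.isEffectiveCartier
    (comap_le_comap_pow_of_le_pow (le_vanishingIdeal_pow_of_forall_idealOrder_eq hX hreg hY) π)

/-- Off the exceptional divisor: a point of `V(J')` lies over `V(J)` and has the same
codimension (the blowing up is a local isomorphism there). [cite: StacksProject, Tag 02OS] -/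
theorem IsBlowup.mem_support_and_coheight_eq_of_not_mem [IsLocallyNoetherian X']
    {C : X.IdealSheafData} (hπ : IsBlowup π C) (I : X.IdealSheafData) (μ : ℕ) {x' : X'}
    (hxC : π x' ∉ C.support) (hx' : x' ∈ (controlledTransform π C I μ).support) :
    π x' ∈ I.support ∧ Order.coheight x' = Order.coheight (π x') := by
  haveI := hπ.isIso_stalkMap_of_not_mem_support hxC
  let ε : X.presheaf.stalk (π x') ≃+* X'.presheaf.stalk x' :=
    (asIso (π.stalkMap x')).commRingCatIsoToRingEquiv
  have hε : (ε : X.presheaf.stalk (π x') →+* X'.presheaf.stalk x') = (π.stalkMap x').hom := rfl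
  constructor
  · by_contra h
    have htop : stalkIdeal (controlledTransform π C I μ) x' = ⊤ := by
      rw [stalkIdeal_controlledTransform_of_not_mem_support I μ hxC,
        stalkIdeal_eq_top_of_not_mem_support h, Ideal.map_top]
    rw [mem_support_iff_stalkIdeal_le, htop, top_le_iff] at hx'
    exact (maximalIdeal.isMaximal _).ne_top hx'
  · have h3 : ringKrullDim (X.presheaf.stalk (π x')) = ringKrullDim (X'.presheaf.stalk x') :=
      ringKrullDim_eq_of_ringEquiv ε
    rw [ringKrullDim_stalk_eq_coheight, ringKrullDim_stalk_eq_coheight] at h3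
    exact_mod_cast h3.symm

set_option maxHeartbeats 400000 in
/-- **On the exceptional divisor the weak transform is the unit ideal at every point of
codimension `≤ 1`** ([CoP1], proof of Prop. 4.2: the new `V(J')` still "has codimension at
least two"; (11) read at the generic point of `E`). Let `π` be a blowing up of the regular
locally Noetherian `X` along a regular centre `Y ⊆ {x | ord_x J = μ}`, and `x' ∈ π⁻¹(Y)` with
`dim 𝒪_{X',x'} ≤ 1`. Then `𝒪_{X',x'}` is the localization of a chart `B_j = 𝒪_{X,s}[P/c_j]`
(`s = π x'`, `P = 𝓘_{Y,s} = (c)` with `c` quasi-regular) at a prime `𝔴 ∋ φ(c_j)` of height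
`≤ 1`; as `(φ c_j)` is a prime (`B_j/(φ c_j) ≅ (𝒪_{X,s}/P)[T]`) containing a nonzerodivisor,
`𝔴 = (φ c_j)` and `P = 𝔴 ∩ 𝒪_{X,s} = 𝔪_s`; for `f ∈ J_s` of order `μ` with initial form `F`,
`φ(f) = φ(c_j)^μ F(e)` with `F(e) ∉ (φ c_j) = 𝔴`, a unit of `𝒪_{X',x'}` lying in `J'_{x'}`.
[cite: CossartPiltant2008, proof of Prop. 4.2, (11)] -/
theorem IsBlowup.stalkIdeal_controlledTransform_eq_top_of_coheight_le_one
    [IsLocallyNoetherian X] [IsLocallyNoetherian X'] (hX : Scheme.IsRegular X) {Y : Closeds X}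
    (hreg : Scheme.IsRegular (vanishingIdeal Y).subscheme) (hπ : IsBlowup π (vanishingIdeal Y))
    {J : X.IdealSheafData} {μ : ℕ} (hY : ∀ y ∈ (Y : Set X), idealOrder J y = μ) {x' : X'}
    (hx : π x' ∈ (Y : Set X)) (hcoh : Order.coheight x' ≤ 1) :
    stalkIdeal (controlledTransform π (vanishingIdeal Y) J μ) x' = ⊤ := by
  classical
  haveI := hX (π x')
  have hxC : π x' ∈ (vanishingIdeal Y).support := by
    rw [← SetLike.mem_coe, coe_support_vanishingIdeal]
    exact hx
  obtain ⟨P, hPdef⟩ : ∃ P : Ideal (X.presheaf.stalk (π x')), P = stalkIdeal (vanishingIdeal Y) (π x') :=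
    ⟨_, rfl⟩
  have hPle : P ≤ maximalIdeal _ := hPdef ▸ (mem_support_iff_stalkIdeal_le _ (π x')).mp hxC
  haveI hPq : IsRegularLocalRing (X.presheaf.stalk (π x') ⧸ P) :=
    hPdef ▸ isRegularLocalRing_stalk_quotient_stalkIdeal hreg hxC
  -- quasi-regular generators `c` of `P`
  obtain ⟨k, c, -, hcspan, hcq, -⟩ :=
    exists_isQuasiRegular_span_eq_of_isRegularLocalRing_quotient hPle (P : Set _) (Ideal.span_eq P)
  haveI : IsDomain (X.presheaf.stalk (π x') ⧸ Ideal.span (Set.range c)) := by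
    rw [hcspan]
    exact isDomain_of_isRegularLocalRing _
  -- the chart presentation `𝒪_{X',x'} = (B_j)_𝔴`
  obtain ⟨j, 𝔴, χ, hχ, hloc, h𝔴⟩ := hπ.exists_reesChart_stalk x' c (hcspan.trans hPdef)
  letI := χ.toAlgebra
  haveI : IsLocalization.AtPrime (X'.presheaf.stalk x') 𝔴.asIdeal := hloc
  obtain ⟨K, hKdef⟩ : ∃ K : Ideal (chartRing c j), K = Ideal.span {chartBase c j (c j)} :=
    ⟨_, rfl⟩
  haveI hKp : K.IsPrime := hKdef ▸ isPrime_span_chartBase_self c j hcq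
  -- `𝓘(E)_{x'} = (χ φ c_j)` is a proper ideal (`x' ∈ E`), so `φ c_j ∈ 𝔴`
  have hu : ∀ l, (π.stalkMap x').hom (c l) = (π.stalkMap x').hom (c j) * χ (chartGen c j l) :=
    fun l => by rw [← hχ, ← hχ, ← map_mul, ← reesChartBase_apply_eq_mul_chartGen c j l]
  have hCmap : (stalkIdeal (vanishingIdeal Y) (π x')).map (π.stalkMap x').hom =
      Ideal.span {χ (chartBase c j (c j))} := by
    rw [← hPdef, ← hcspan, Ideal.map_span_range_eq_span_singleton _ c j _ hu, ← hχ]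
  have hE : stalkIdeal ((vanishingIdeal Y).comap π) x' ≠ ⊤ := by
    have hmem : x' ∈ ((vanishingIdeal Y).comap π).support := by
      rw [Scheme.IdealSheafData.support_comap]
      exact hxC
    intro htop
    rw [mem_support_iff_stalkIdeal_le, htop, top_le_iff] at hmem
    exact (maximalIdeal.isMaximal _).ne_top hmem
  have hK𝔴 : K ≤ 𝔴.asIdeal := by
    rw [hKdef, Ideal.span_singleton_le_iff_mem]
    by_contra hnot
    apply hE
    rw [stalkIdeal_comap_eq_map_stalkMap, hCmap, Ideal.span_singleton_eq_top]
    exact IsLocalization.map_units (X'.presheaf.stalk x') (⟨_, hnot⟩ : 𝔴.asIdeal.primeCompl)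
  -- heights: `ht 𝔴 = dim 𝒪_{X',x'} ≤ 1`, `ht K ≥ 1`, hence `K = 𝔴`
  have h𝔴ht : 𝔴.asIdeal.height ≤ 1 := by
    have h1 := IsLocalization.AtPrime.ringKrullDim_eq_height 𝔴.asIdeal (X'.presheaf.stalk x')
    rw [ringKrullDim_stalk_eq_coheight] at h1
    have h2 : ((𝔴.asIdeal.height : ℕ∞) : WithBot ℕ∞) ≤ ((1 : ℕ∞) : WithBot ℕ∞) := by
      rw [← h1]
      exact_mod_cast hcoh
    exact_mod_cast h2
  have hK𝔴eq : K = 𝔴.asIdeal :=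
    Ideal.eq_of_le_of_height_le_one_of_mem_nonZeroDivisors hK𝔴 h𝔴ht
      (hKdef ▸ Ideal.mem_span_singleton_self _) (reesChartBase_mem_nonZeroDivisors _ _)
  -- hence `P = 𝔪_s`: `x'` lies over the generic point of `Y`
  have hPm : P = maximalIdeal (X.presheaf.stalk (π x')) := by
    rw [← h𝔴, ← hK𝔴eq, hKdef, comap_span_chartBase_self c j hcq, hcspan]
  have hcm : Ideal.span (Set.range c) = maximalIdeal _ := hcspan.trans hPm
  -- an element of `J_s` of order exactly `μ`, its initial form and weak transform
  have hord := hY (π x') hx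
  have hJle : stalkIdeal J (π x') ≤ maximalIdeal _ ^ μ := (le_idealOrder_iff J _ μ).mp hord.ge
  have hJnot : ¬ stalkIdeal J (π x') ≤ maximalIdeal _ ^ (μ + 1) := by
    rw [← le_idealOrder_iff, hord]
    exact_mod_cast Nat.not_succ_le_self μ
  obtain ⟨f, hfJ, hf'⟩ := Set.not_subset.mp hJnot
  obtain ⟨f', hff', hf'K⟩ := exists_weakTransform_chart_not_mem_span c j hcm hcq (hJle hfJ) hf'
  have hf'𝔴 : f' ∉ 𝔴.asIdeal := by
    rw [← hK𝔴eq, hKdef]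
    exact hf'K
  -- `χ f'` is a unit of `𝒪_{X',x'}` lying in `J'_{x'}`
  have hunit : IsUnit (χ f') :=
    IsLocalization.map_units (X'.presheaf.stalk x') (⟨_, hf'𝔴⟩ : 𝔴.asIdeal.primeCompl)
  have hmem : χ f' ∈ stalkIdeal (controlledTransform π (vanishingIdeal Y) J μ) x' := by
    rw [controlledTransform, stalkIdeal_colon, stalkIdeal_pow, stalkIdeal_comap_eq_map_stalkMap,
      stalkIdeal_comap_eq_map_stalkMap, hCmap]
    exact map_mem_colon_of_eq_pow_mul (chartBase c j) χ (π.stalkMap x').hom hχ hff' hfJ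
  exact Ideal.eq_top_of_isUnit_mem _ hmem hunit

/-- **"`V(J')` has codimension at least two"** is preserved ([CoP1], proof of Prop. 4.2): if
every point of `V(J)` has codimension `> 1`, so does every point of `V(J')` for the weak
transform `J'` under a blowing up along a regular centre `Y ⊆ {ord_x J = μ}` — off `E` the
blowing up is a local isomorphism, on `E` use
`IsBlowup.stalkIdeal_controlledTransform_eq_top_of_coheight_le_one`.
[cite: CossartPiltant2008, proof of Prop. 4.2] -/
theorem IsBlowup.one_lt_coheight_of_mem_support_controlledTransform
    [IsLocallyNoetherian X] [IsLocallyNoetherian X'] (hX : Scheme.IsRegular X) {Y : Closeds X}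
    (hreg : Scheme.IsRegular (vanishingIdeal Y).subscheme) (hπ : IsBlowup π (vanishingIdeal Y))
    {J : X.IdealSheafData} {μ : ℕ} (hY : ∀ y ∈ (Y : Set X), idealOrder J y = μ)
    (hJ : ∀ x ∈ J.support, 1 < Order.coheight x) {x' : X'}
    (hx' : x' ∈ (controlledTransform π (vanishingIdeal Y) J μ).support) :
    1 < Order.coheight x' := by
  by_cases hx : π x' ∈ (Y : Set X)
  · by_contra hle
    rw [not_lt] at hle
    have htop := hπ.stalkIdeal_controlledTransform_eq_top_of_coheight_le_one hX hreg hY hx hle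
    rw [mem_support_iff_stalkIdeal_le, htop, top_le_iff] at hx'
    exact (maximalIdeal.isMaximal _).ne_top hx'
  · have hxC : π x' ∉ (vanishingIdeal Y).support := by
      rwa [← SetLike.mem_coe, coe_support_vanishingIdeal]
    obtain ⟨hsupp, hcoh⟩ := hπ.mem_support_and_coheight_eq_of_not_mem J μ hxC hx'
    rw [hcoh]
    exact hJ _ hsupp

end Transform

/-! ## Permissible centres lie in the non-locally-principal locus of `I𝒪 = H · J` -/

section NonPrincipal

variable {X : Scheme.{u}}

/-- **A point of `V(J)` is a point where `H · J` is not locally principal**, for `H` an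
effective Cartier divisor and `V(J)` of codimension `≥ 2` on an integral locally Noetherian
scheme ([CoP1], proof of Prop. 4.2: the centres `Y ⊆ Σ ⊆ V(J)` lie in
`{I𝒪 is not locally principal}`, `I𝒪 = H · J`): were `(H · J)_y = (f)`, cancelling the
invertible `H_y = (h)` would make `J_y = (g)` a proper non-zero principal ideal, and a
height-one prime over `g` is a codimension-one point of `V(J)`.
[cite: CossartPiltant2008, proof of Prop. 4.2] -/
theorem not_isLocallyPrincipalAt_mul_of_forall_one_lt_coheight [IsIntegral X]
    [IsLocallyNoetherian X] {H J : X.IdealSheafData} (hH : IsEffectiveCartier H) (hJ0 : J ≠ ⊥)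
    (hJ : ∀ x ∈ J.support, 1 < Order.coheight x) {y : X} (hy : y ∈ J.support) :
    ¬ IsLocallyPrincipalAt (H * J) y := by
  intro hprin
  obtain ⟨f, hf⟩ := hprin.isPrincipal_stalkIdeal
  replace hf : stalkIdeal (H * J) y = Ideal.span {f} := hf
  -- `H_y = (h)` with `h ≠ 0`
  obtain ⟨U, hyU, h₀, hh₀, hHU⟩ := hH y
  set h : X.presheaf.stalk y := (X.presheaf.germ U y hyU).hom h₀ with hhdef
  have hh : stalkIdeal H y = Ideal.span {h} := by
    rw [stalkIdeal_eq_map_germ H U hyU, hHU, Ideal.map_span, Set.image_singleton]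
  haveI : Nontrivial Γ(X, U) := (X.presheaf.germ U y hyU).hom.domain_nontrivial
  have hh0 : h ≠ 0 := by
    rw [hhdef]
    intro h0
    apply nonZeroDivisors.ne_zero hh₀
    apply germ_injective_of_isIntegral X y hyU
    change (X.presheaf.germ U y hyU).hom h₀ = (X.presheaf.germ U y hyU).hom 0
    rw [map_zero]
    exact h0
  have e : Ideal.span {h} * stalkIdeal J y = Ideal.span {f} := by
    rw [← hh, ← hf, ← stalkIdeal_mul]
  obtain ⟨g, -, hJg⟩ := Ideal.exists_eq_span_singleton_of_span_singleton_mul_eq hh0 e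
  -- `g` is a non-zero non-unit
  have hJ0' : stalkIdeal J y ≠ ⊥ := stalkIdeal_ne_bot_of_ne_bot hJ0 y
  have hg0 : g ≠ 0 := by
    rintro rfl
    rw [Ideal.span_singleton_eq_bot.mpr rfl] at hJg
    exact hJ0' hJg
  have hgu : ¬ IsUnit g := by
    intro hu
    have := (mem_support_iff_stalkIdeal_le _ y).mp hy
    rw [hJg, Ideal.span_singleton_le_iff_mem] at this
    exact (mem_maximalIdeal _).mp this hu
  -- a height-one prime over `g`: a codimension-one generization `ζ ⤳ y` inside `V(J)`
  obtain ⟨P, hP, hP1, hgP⟩ := Ideal.exists_height_eq_one_of_mem_nonunits hg0 hgu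
  haveI := hP
  obtain ⟨ζ, hζy, hPζ⟩ := exists_specializes_comap_stalkSpecializes_eq y P
  have hcoh : Order.coheight ζ = 1 := by
    have h1 := coe_height_primeOfSpecializes hζy
    rw [primeOfSpecializes, ← hPζ, hP1] at h1
    exact_mod_cast h1.symm
  have hζsupp : ζ ∈ J.support := by
    rw [mem_support_iff_stalkIdeal_le, ← stalkIdeal_map_stalkSpecializes _ hζy, hJg,
      Ideal.map_span, Set.image_singleton, Ideal.span_singleton_le_iff_mem]
    have : g ∈ primeOfSpecializes hζy := by rw [primeOfSpecializes, ← hPζ]; exact hgP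
    exact this
  exact absurd (hJ ζ hζsupp) (by rw [hcoh]; decide)

end NonPrincipal


end Literature.AlgebraicGeometry.Resolution

end
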